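import Summits.Ventures.PercRepro.RankLevelSetLevelSevenRowsFiftySixToSixtyFour
import Summits.Ventures.PercRepro.RankLevelSetLevelSevenRowFiftyFive
import Summits.Ventures.PercRepro.RankLevelSetLevelSevenRowFiftyFour

/-!
# PercRepro — THE ROWS `55` AND `54` OF LEVEL `7`: C-025 AT `q = 7` FOR EVERY FINITE MATROID AND EVERY `p ≥ 54`, ON THE
TELESCOPING COUNT WITH T4⁺ AND THE CAPPED TAIL (p8, gen 21; a feeder for S4 — the top of the `q = 7` window moves from `56`
to `54`)

Each row from the row above and its own rank: `c025_seven_large_<word> (P ≤ p) : RLS M p 7` is `c025_seven_at_<word>`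
(RankLevelSetLevelSevenRow<Word>: the `e`-free core at rank `P` on the telescoping count with p1's T4⁺ and the
nullity-capped `Y`-tail, `rls_succ_large_at 6 7 P` on `c025_six_all`) at `p = P` and the row `P + 1` above it; the row
`56` is p8 g20's `c025_seven_large_fifty_six` (RankLevelSetLevelSevenRowsFiftySixToSixtyFour). The chain `55 → 54`; the
literal `C025` body at `54` (`c025_seven_fifty_four`). Axioms: standard.
-/

open scoped Matroid

namespace PercRepro

namespace ThmN

variable {α : Type}

/-- **THEOREM C₇ AT `55`, UNCONDITIONAL OVER THE TREE**: every finite matroid satisfies C-025 at level `7` for every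
`p ≥ 55` — the row `55` by `c025_seven_at_fifty_five`, the rows `≥ 56` by `c025_seven_large_fifty_six`. -/
theorem c025_seven_large_fifty_five (M : Matroid α) [M.Finite] (p : ℕ) (hp : 55 ≤ p) : RLS M p 7 := by
  rcases Nat.lt_or_ge p 56 with h | h
  · have h55 : p = 55 := by omega
    subst h55
    exact c025_seven_at_fifty_five M
  · exact c025_seven_large_fifty_six M p h

/-- **THEOREM C₇ AT `54`, UNCONDITIONAL OVER THE TREE**: every finite matroid satisfies C-025 at level `7` for every
`p ≥ 54` — the row `54` by `c025_seven_at_fifty_four`, the rows `≥ 55` by `c025_seven_large_fifty_five`. -/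
theorem c025_seven_large_fifty_four (M : Matroid α) [M.Finite] (p : ℕ) (hp : 54 ≤ p) : RLS M p 7 := by
  rcases Nat.lt_or_ge p 55 with h | h
  · have h54 : p = 54 := by omega
    subst h54
    exact c025_seven_at_fifty_four M
  · exact c025_seven_large_fifty_five M p h

/-- The same in the literal `C025` body: `phiK p 7 · #U(p, 7) ≤ #Y(p, 7)` for every finite matroid and every `p ≥ 54`. -/
theorem c025_seven_fifty_four (M : Matroid α) [M.Finite] (p : ℕ) (hp : 54 ≤ p) :
    phiK p 7 * ({A : Set α | A ⊆ M.E ∧ M.eRk A = (p : ℕ∞) ∧ M.eRk (M.E \ A) = (7 : ℕ∞)}.ncard : ℚ) ≤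
      ({A : Set α | A ⊆ M.E ∧ (7 : ℕ∞) < M.eRk A ∧ M.eRk A < (p : ℕ∞)}.ncard : ℚ) :=
  c025_seven_large_fifty_four M p hp

end ThmN

end PercRepro
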